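import Mathlib.RingTheory.DedekindDomain.Different
import Mathlib.RingTheory.DiscreteValuationRing.Basic
import HarnessLib

/-!
# Lenstra's generalisation of Dedekind's different bound (Javanpeykar 2014, Prop. 4.1.1)

Topic `NumberTheory/NumberFields`. Theorem-only file (no definition, no named fact).

Printed statement [cite: Javanpeykar2014, Prop. 4.1.1] ("(H. W. Lenstra jr.)"): *Let `A` be a discrete
valuation ring of characteristic zero with fraction field `K`, and let `B` be the integral closure of
`A` in a finite field extension `L/K` of degree `n`. Suppose that `B` is a discrete valuation ring of
ramification index `e` over `A`. Then the valuation `r` of the different ideal `𝔇_{B/A}` on `B`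
satisfies `r ≤ e - 1 + e · ord_A(n)`.* Printed proof: for a uniformiser `x` of `A` the element
`y = 1/(nx) ∈ K` has trace `Tr_{L/K}(y) = 1/x ∉ A`, so the inverse different does not contain `y`,
i.e. the different `𝔇_{B/A}` is **not** contained in the ideal `(nx)`; as the ideals of the DVR `B`
are totally ordered, `ord_B(𝔇_{B/A}) < ord_B(nx) = e (ord_A(n) + 1)`. (Remark 4.1.2: for separable
residue extensions this is the Remarque after Prop. III.6.13 of Serre's *Corps locaux*, Dedekind's
conjecture proved by Hensel for `A = ℤ`; the point of 4.1.1 is that no residual separability is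
needed.)

## What is proved

* `not_span_dvd_differentIdeal` — the trace argument in the generality in which Mathlib's different
  ideal lives: `A ⊆ B` Dedekind domains with fraction fields `K ⊆ L`, `B` finite and torsion-free
  over `A`, `L/K` finite separable of degree `n`; for every non-unit `x ∈ A` with `n ≠ 0` in `A`:
  **`(n x) B ∤ 𝔇_{B/A}`**, i.e. `𝔇_{B/A} ⊄ (nx)`. (From Mathlib's
  `not_dvd_differentIdeal_of_intTrace_not_mem` with `P = (nx)`, `Q = B`, and the element `1`, whose
  trace `n` is not in `(nx) A`.) In characteristic `0` the hypothesis `n ≠ 0` is automatic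
  (`not_span_dvd_differentIdeal_of_charZero`).
* `exists_map_maximalIdeal_eq_pow` — for `A ⊆ B` discrete valuation rings (finite, torsion-free),
  `𝔪_A B = 𝔪_B ^ e` for some `e ≥ 1` (the ramification index of `B/A`, which the statements below
  take as the hypothesis `he : 𝔪_A B = 𝔪_B ^ e`).
* `not_pow_dvd_differentIdeal`, `emultiplicity_differentIdeal_lt` / `emultiplicity_differentIdeal_le`
  (`…_of_charZero`) — **Prop. 4.1.1 as printed** for `A ⊆ B` discrete valuation rings: with
  `k = ord_A(n)` (`IsDiscreteValuationRing.addVal A n = k`), `𝔪_B ^ (e (k+1)) ∤ 𝔇_{B/A}`, i.e.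
  `ord_B(𝔇_{B/A}) < e (k + 1)`, i.e. `ord_B(𝔇_{B/A}) ≤ e - 1 + e k`, the order being the multiplicity
  `emultiplicity 𝔪_B 𝔇_{B/A}`.

All statements are over an arbitrary "AKLB square": fraction fields `K` of `A` and `L` of `B` with
`L/K` finite separable (no `FractionRing` instance is needed by users; the proofs transport
separability to Mathlib's `FractionRing.liftAlgebra` internally, exactly as
`coeSubmodule_differentIdeal` of `Mathlib.RingTheory.DedekindDomain.Different` does).

The hypotheses "`B` is the integral closure of `A` in `L`, `[L : K] = n`, characteristic `0`" of the
source imply the ones used here (`B` is then Dedekind, finite free over the PID `A`, and `L/K` is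
separable); nothing is asserted beyond what is proved.

## References

* A. Javanpeykar, *Polynomial bounds for Arakelov invariants of Belyi curves*, Algebra & Number
  Theory 8 (2014) 89–140, arXiv:1403.6404, §4.1, Prop. 4.1.1 and Remark 4.1.2. [Javanpeykar2014]
* J.-P. Serre, *Corps locaux*, Ch. III §6, Prop. 13 and the Remarque following it.
-/

namespace Literature.NumberTheory.NumberFields

open IsLocalRing nonZeroDivisors

/-! ### The trace argument: `𝔇_{B/A} ⊄ (n x)` -/

section Dedekind

variable (A K L B : Type*) [CommRing A] [IsDedekindDomain A] [Field K] [Algebra A K]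
  [IsFractionRing A K] [CommRing B] [IsDedekindDomain B] [Field L] [Algebra B L] [IsFractionRing B L]
  [Algebra A B] [Module.Finite A B] [Module.IsTorsionFree A B]
  [Algebra K L] [Algebra A L] [IsScalarTower A K L] [IsScalarTower A B L]
  [FiniteDimensional K L] [Algebra.IsSeparable K L]

include K L in
omit [FiniteDimensional K L] in
/-- Transport of separability from the given fraction fields `K ⊆ L` to Mathlib's
`FractionRing A → FractionRing B` (`FractionRing.liftAlgebra`), verbatim the device of
`coeSubmodule_differentIdeal` in `Mathlib.RingTheory.DedekindDomain.Different`. [folklore] -/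
theorem isSeparable_fractionRing_of_isSeparable :
    letI := FractionRing.liftAlgebra A (FractionRing B)
    Algebra.IsSeparable (FractionRing A) (FractionRing B) := by
  letI := FractionRing.liftAlgebra A (FractionRing B)
  haveI := FractionRing.isScalarTower_liftAlgebra A (FractionRing B)
  have H : RingHom.comp (algebraMap (FractionRing A) (FractionRing B))
      ↑(FractionRing.algEquiv A K).symm.toRingEquiv =
        RingHom.comp ↑(FractionRing.algEquiv B L).symm.toRingEquiv (algebraMap K L) := by
    apply IsLocalization.ringHom_ext A⁰
    ext
    simp only [RingHom.coe_comp, RingHom.coe_coe, AlgEquiv.coe_ringEquiv, Function.comp_apply,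
      AlgEquiv.commutes, ← IsScalarTower.algebraMap_apply]
    rw [IsScalarTower.algebraMap_apply A B L, AlgEquiv.commutes, ← IsScalarTower.algebraMap_apply]
  exact Algebra.IsSeparable.of_equiv_equiv _ _ H

omit [IsDedekindDomain A] [IsDedekindDomain B] [Algebra.IsSeparable K L] in
/-- The trace from `B` to `A` of `1` is the degree `n = [L : K]`. [folklore] -/
theorem intTrace_one [IsDomain A] [IsIntegrallyClosed A] [IsDomain B] [IsIntegrallyClosed B] :
    Algebra.intTrace A B 1 = (Module.finrank K L : A) := by
  haveI : IsIntegralClosure B A L := IsIntegralClosure.of_isIntegrallyClosed _ _ _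
  apply IsFractionRing.injective A K
  rw [Algebra.algebraMap_intTrace (K := K) (L := L), map_one, map_natCast,
    ← map_one (algebraMap K L), Algebra.trace_algebraMap, nsmul_eq_mul, mul_one]

/-- **Lenstra's trace argument** ([cite: Javanpeykar2014, Prop. 4.1.1], proof): let `A ⊆ B` be
Dedekind domains with fraction fields `K ⊆ L`, `B` finite and torsion-free over `A`, `L/K` finite
separable of degree `n`; let `x ∈ A` be a non-unit and suppose `n ≠ 0` in `A`. Then the ideal
`(n x) B` does **not** divide the different `𝔇_{B/A}` (i.e. `𝔇_{B/A} ⊄ (n x) B`): otherwise the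
trace of `(nx)⁻¹ B ∋ (nx)⁻¹` would be integral, but `Tr(1/(nx)) = 1/x ∉ A`. In Mathlib's form:
`1 ∈ B` has trace `n ∉ (n x) A` (`x` is not a unit), and `not_dvd_differentIdeal_of_intTrace_not_mem`
applies with `P = (nx) B`, `Q = B`. [cite: Javanpeykar2014, Prop. 4.1.1] -/
theorem not_span_dvd_differentIdeal {x : A} (hx : ¬ IsUnit x) (hn : (Module.finrank K L : A) ≠ 0) :
    ¬ Ideal.span {algebraMap A B ((Module.finrank K L : A) * x)} ∣ differentIdeal A B := by
  letI := FractionRing.liftAlgebra A (FractionRing B)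
  haveI : Algebra.IsSeparable (FractionRing A) (FractionRing B) :=
    isSeparable_fractionRing_of_isSeparable A K L B
  set n : ℕ := Module.finrank K L with hn'
  refine not_dvd_differentIdeal_of_intTrace_not_mem A (p := Ideal.span {(n : A) * x})
    (Ideal.span {algebraMap A B ((n : A) * x)}) ⊤ ?_ 1 Submodule.mem_top ?_
  · rw [Ideal.mul_top, Ideal.map_span, Set.image_singleton]
  · rw [intTrace_one A K L B, ← hn', Ideal.mem_span_singleton']
    rintro ⟨c, hc⟩
    have h1 : (n : A) * (c * x - 1) = 0 := by linear_combination hc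
    rcases mul_eq_zero.1 h1 with h | h
    · exact hn h
    · exact hx (IsUnit.of_mul_eq_one c (by rw [mul_comm]; exact sub_eq_zero.1 h))

/-- In characteristic `0` the degree is automatically non-zero in `A`: for a non-unit `x ∈ A`,
`(n x) B ∤ 𝔇_{B/A}`. [cite: Javanpeykar2014, Prop. 4.1.1] -/
theorem not_span_dvd_differentIdeal_of_charZero [CharZero A] {x : A} (hx : ¬ IsUnit x) :
    ¬ Ideal.span {algebraMap A B ((Module.finrank K L : A) * x)} ∣ differentIdeal A B :=
  not_span_dvd_differentIdeal A K L B hx (by exact_mod_cast (Module.finrank_pos (R := K) (M := L)).ne')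

end Dedekind

/-! ### Discrete valuation rings: the printed inequality `ord_B(𝔇) ≤ e - 1 + e · ord_A(n)` -/

section DVR

variable (A K L B : Type*) [CommRing A] [IsDomain A] [IsDiscreteValuationRing A] [Field K]
  [Algebra A K] [IsFractionRing A K] [CommRing B] [IsDomain B] [IsDiscreteValuationRing B] [Field L]
  [Algebra B L] [IsFractionRing B L] [Algebra A B] [Module.Finite A B] [Module.IsTorsionFree A B]
  [Algebra K L] [Algebra A L] [IsScalarTower A K L] [IsScalarTower A B L]
  [FiniteDimensional K L] [Algebra.IsSeparable K L]

omit [Field K] [Algebra A K] [IsFractionRing A K] [Field L] [Algebra B L] [IsFractionRing B L]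
  [Algebra K L] [Algebra A L] [IsScalarTower A K L] [IsScalarTower A B L] [FiniteDimensional K L]
  [Algebra.IsSeparable K L] in
/-- **The ramification index of an extension of discrete valuation rings.** For a finite
torsion-free extension `A ⊆ B` of discrete valuation rings, `𝔪_A B` is a proper non-zero ideal of
`B`, hence `𝔪_A B = 𝔪_B ^ e` for a (unique) `e ≥ 1` — the ramification index of `B` over `A`
(Serre, *Corps locaux*, Ch. I §4). [folklore] -/
theorem exists_map_maximalIdeal_eq_pow :
    ∃ e : ℕ, 1 ≤ e ∧ (maximalIdeal A).map (algebraMap A B) = maximalIdeal B ^ e := by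
  obtain ⟨ϖB, hϖB⟩ := IsDiscreteValuationRing.exists_irreducible B
  set I := (maximalIdeal A).map (algebraMap A B) with hI
  have hinj : Function.Injective (algebraMap A B) := FaithfulSMul.algebraMap_injective A B
  -- `I ≠ ⊥`
  have hI0 : I ≠ ⊥ := by
    rw [hI, Ne, Ideal.map_eq_bot_iff_of_injective hinj]
    exact IsDiscreteValuationRing.not_a_field A
  -- `I ≠ ⊤`: there is a maximal ideal of `B` over `𝔪_A` (`B/A` is integral)
  have hItop : I ≠ ⊤ := by
    obtain ⟨Q, hQmax, hQ⟩ := Ideal.exists_ideal_over_maximal_of_isIntegral (S := B) (maximalIdeal A)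
      (by rw [(RingHom.injective_iff_ker_eq_bot _).1 hinj]; exact bot_le)
    intro htop
    apply hQmax.ne_top
    rw [eq_top_iff, ← htop, hI, Ideal.map_le_iff_le_comap, hQ]
  -- so `I = 𝔪_B ^ e` for some `e ≥ 1`
  obtain ⟨e, he⟩ := IsDiscreteValuationRing.ideal_eq_span_pow_irreducible hI0 hϖB
  rw [← Ideal.span_singleton_pow, ← hϖB.maximalIdeal_eq] at he
  refine ⟨e, ?_, he⟩
  rcases Nat.eq_zero_or_pos e with h | h
  · rw [h, pow_zero, Ideal.one_eq_top] at he
    exact absurd he hItop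
  · exact h

/-- **Javanpeykar 2014, Prop. 4.1.1 (Lenstra), non-divisibility form.** `A ⊆ B` discrete valuation
rings with fraction fields `K ⊆ L`, `B` finite torsion-free over `A`, `L/K` finite separable of degree
`n` with `n ≠ 0` in `A` (e.g. characteristic `0`), ramification index `e` (`𝔪_A B = 𝔪_B ^ e`),
`k = ord_A(n)`. Then `𝔪_B ^ (e (k + 1)) ∤ 𝔇_{B/A}` — because `𝔪_B ^ (e (k + 1)) = (n ϖ_A) B` for a
uniformiser `ϖ_A` of `A`, and `not_span_dvd_differentIdeal`. [cite: Javanpeykar2014, Prop. 4.1.1] -/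
theorem not_pow_dvd_differentIdeal (hn : (Module.finrank K L : A) ≠ 0) {k : ℕ}
    (hk : IsDiscreteValuationRing.addVal A (Module.finrank K L : A) = k) {e : ℕ}
    (he : (maximalIdeal A).map (algebraMap A B) = maximalIdeal B ^ e) :
    ¬ maximalIdeal B ^ (e * (k + 1)) ∣ differentIdeal A B := by
  set n : ℕ := Module.finrank K L with hn'
  obtain ⟨ϖ, hϖ⟩ := IsDiscreteValuationRing.exists_irreducible A
  -- `n = u ϖ ^ k`
  obtain ⟨m, u, hu⟩ := IsDiscreteValuationRing.associated_pow_irreducible hn hϖ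
  have hmk : m = k := by
    have h := IsDiscreteValuationRing.addVal_def (n : A) u⁻¹ hϖ m
      (by rw [← hu, mul_comm (n : A) (u : A), ← mul_assoc, Units.inv_mul, one_mul])
    rw [hk] at h
    exact_mod_cast h.symm
  subst hmk
  -- `(n ϖ) B = 𝔪_B ^ (e (m + 1))`
  have hspan : Ideal.span {algebraMap A B ((n : A) * ϖ)} = maximalIdeal B ^ (e * (m + 1)) := by
    have hassoc : Associated ((n : A) * ϖ) (ϖ ^ (m + 1)) := by
      rw [pow_succ]
      exact Associated.mul_right (⟨u, hu⟩ : Associated (n : A) (ϖ ^ m)) ϖ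
    rw [← Set.image_singleton, ← Ideal.map_span, Ideal.span_singleton_eq_span_singleton.2 hassoc,
      ← Ideal.span_singleton_pow, ← hϖ.maximalIdeal_eq, Ideal.map_pow, he, ← pow_mul]
  rw [← hspan]
  exact not_span_dvd_differentIdeal A K L B hϖ.not_isUnit hn

/-- **Javanpeykar 2014, Prop. 4.1.1**, strict form: under the hypotheses of
`not_pow_dvd_differentIdeal`, the multiplicity `r = ord_B(𝔇_{B/A})` of `𝔪_B` in the different
satisfies `r < e (k + 1)` — the last display of the printed proof,
`ord_B(𝔇_{B/A}) < ord_B(nx) = e (ord_A(n) + 1)`. [cite: Javanpeykar2014, Prop. 4.1.1] -/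
theorem emultiplicity_differentIdeal_lt (hn : (Module.finrank K L : A) ≠ 0) {k : ℕ}
    (hk : IsDiscreteValuationRing.addVal A (Module.finrank K L : A) = k) {e : ℕ}
    (he : (maximalIdeal A).map (algebraMap A B) = maximalIdeal B ^ e) :
    emultiplicity (maximalIdeal B) (differentIdeal A B) < (e * (k + 1) : ℕ) := by
  rw [← not_le, ← pow_dvd_iff_le_emultiplicity]
  exact not_pow_dvd_differentIdeal A K L B hn hk he

/-- **Javanpeykar 2014, Prop. 4.1.1 (Lenstra's generalisation of Dedekind's different bound), as
printed: `r ≤ e - 1 + e · ord_A(n)`.** For `A ⊆ B` discrete valuation rings with fraction fields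
`K ⊆ L`, `B` finite torsion-free over `A`, `L/K` finite separable of degree `n`, `n ≠ 0` in `A`
(automatic in characteristic `0`, `emultiplicity_differentIdeal_le_of_charZero`), ramification index
`e` (`𝔪_A B = 𝔪_B ^ e`) and `k = ord_A(n)`: the multiplicity `r` of `𝔪_B` in `𝔇_{B/A}` satisfies
`r ≤ e - 1 + e k`. [cite: Javanpeykar2014, Prop. 4.1.1] -/
theorem emultiplicity_differentIdeal_le (hn : (Module.finrank K L : A) ≠ 0) {k : ℕ}
    (hk : IsDiscreteValuationRing.addVal A (Module.finrank K L : A) = k) {e : ℕ}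
    (he : (maximalIdeal A).map (algebraMap A B) = maximalIdeal B ^ e) :
    emultiplicity (maximalIdeal B) (differentIdeal A B) ≤ (e - 1 + e * k : ℕ) := by
  have hlt := emultiplicity_differentIdeal_lt A K L B hn hk he
  obtain ⟨r, hr⟩ := ENat.ne_top_iff_exists.1 (ne_top_of_lt hlt)
  rw [← hr] at hlt ⊢
  have hlt' : r < e * (k + 1) := by exact_mod_cast hlt
  have hle : r ≤ e - 1 + e * k := by
    rcases e with _ | e
    · omega
    · have : (e + 1) * (k + 1) = e + 1 - 1 + (e + 1) * k + 1 := by ring_nf; omega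
      omega
  exact_mod_cast hle

/-- Characteristic `0` version of Prop. 4.1.1 (the setting of the source: "a discrete valuation ring
of characteristic zero"): `ord_B(𝔇_{B/A}) ≤ e - 1 + e · ord_A(n)`. [cite: Javanpeykar2014, Prop. 4.1.1] -/
theorem emultiplicity_differentIdeal_le_of_charZero [CharZero A] {k : ℕ}
    (hk : IsDiscreteValuationRing.addVal A (Module.finrank K L : A) = k) {e : ℕ}
    (he : (maximalIdeal A).map (algebraMap A B) = maximalIdeal B ^ e) :
    emultiplicity (maximalIdeal B) (differentIdeal A B) ≤ (e - 1 + e * k : ℕ) :=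
  emultiplicity_differentIdeal_le A K L B
    (by exact_mod_cast (Module.finrank_pos (R := K) (M := L)).ne') hk he

end DVR

end Literature.NumberTheory.NumberFields
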